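import Summits.Parity.BatemanHorn.Theorems.SoloInformedConvexSpacing
import Summits.Parity.BatemanHorn.Theorems.SoloInformedRootConvexity
import Summits.Parity.BatemanHorn.Theorems.SoloInformedPolynomialGrowth
import Mathlib.Analysis.SpecialFunctions.Pow.Asymptotics

/-!
# SoloInformedMidPowerValues — `k`-th power values of a polynomial of degree `d ∈ (k, 2k)` are `o(x / log x)`

Solo unit `solo-Parity-informed` (ideation tier, informed mode), session 15; `PLAN.md` §23, CLAIMS C65.

`eventually_card_midPowValues_mul_log_le`: for `g ∈ ℤ[X]` with positive leading coefficient, degree `d`, and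
an exponent `k` with `k < d < 2k`, and every `δ > 0`, eventually
`#{1 ≤ n ≤ x : |g(n)| = m^k for some m} · log x ≤ δ x`.

WEYL-FREE, SIEVE-FREE PROOF (Jarník's convexity argument run with the size of `φ''`): along solutions,
`m = φ(n) = g(n)^{1/k}`; by `SoloInformedRootConvexity` the chord slopes of `φ` over `n₀ < n₁ < n₂` (all
`≥ y ≥ T₁`) increase by at most `M y^{d/k-2}(n₂ - n₀)`, and by `SoloInformedConvexSpacing` an increase of
INTEGER-point slopes costs `4 ≤ M y^{d/k-2} (n₂ - n₀)³`; so the solutions `≥ √x` are three-wise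
`≥ (4/M)^{1/3} x^{(2-d/k)/6}` apart and number `≪ x^{1-(2-d/k)/6}`, while those `< √x` are at most `√x`.
No irreducibility is needed.  This settles the exponents `d/2 < k < d` of the proper-prime-power hypothesis
`hPP` (first new case `(d, k) = (4, 3)`: cubes among quartic values), complementing
`SoloInformedPowerValuesCount` (`k = d`) and `SoloInformedPrimeSquareValues` (`k = 2`).
-/

namespace Summit.Parity.BatemanHorn.Theorems

open Finset Filter Polynomial Asymptotics
open scoped Topology

/-- **Three-point spacing of `k`-th power values.**  For `g ∈ ℤ[X]` with positive leading coefficient and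
`0 < k < deg g < 2k`: there are `T₁ ≥ 1`, `M > 0` such that for every `y ≥ T₁` and all naturals
`y ≤ n₀ < n₁ < n₂` at which `|g|` takes `k`-th power values, `4 ≤ M y^{d/k-2} (n₂ - n₀)³`. -/
theorem exists_three_spacing_powValues {g : ℤ[X]} {k : ℕ} (hk : 0 < k) (hkd : k < g.natDegree)
    (hdk : g.natDegree < 2 * k) (hlc : 0 < g.leadingCoeff) :
    ∃ T₁ M : ℝ, 1 ≤ T₁ ∧ 0 < M ∧ ∀ y : ℝ, T₁ ≤ y → ∀ n₀ n₁ n₂ : ℕ, y ≤ n₀ → n₀ < n₁ → n₁ < n₂ →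
      (∃ m : ℕ, (g.eval (n₀ : ℤ)).natAbs = m ^ k) → (∃ m : ℕ, (g.eval (n₁ : ℤ)).natAbs = m ^ k) →
      (∃ m : ℕ, (g.eval (n₂ : ℤ)).natAbs = m ^ k) →
        4 ≤ M * y ^ ((g.natDegree : ℝ) / k - 2) * ((n₂ : ℝ) - n₀) ^ 3 := by
  set G : ℝ[X] := g.map (Int.castRingHom ℝ) with hG
  have hinj : Function.Injective (Int.castRingHom ℝ) := Int.cast_injective
  have hdeg : G.natDegree = g.natDegree := natDegree_map_eq_of_injective hinj _
  have hlcG : 0 < G.leadingCoeff := by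
    rw [hG, leadingCoeff_map_of_injective hinj]
    simp only [eq_intCast]
    exact_mod_cast hlc
  have hd2 : 2 ≤ G.natDegree := by rw [hdeg]; omega
  have hkd' : k < G.natDegree := by rw [hdeg]; exact hkd
  obtain ⟨T₁, M, hT₁, hM, hDD⟩ := exists_polyRootFunDD_pos_le G hk hd2 hkd' hlcG
  refine ⟨T₁, M, hT₁, hM, fun y hy n₀ n₁ n₂ hyn h₀₁ h₁₂ hm₀ hm₁ hm₂ => ?_⟩
  have hk0 : (0 : ℝ) < k := by exact_mod_cast hk
  have he : (G.natDegree : ℝ) / k - 2 ≤ 0 := by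
    rw [hdeg, sub_nonpos, div_le_iff₀ hk0]
    exact_mod_cast hdk.le
  have hy0 : 0 < y := by linarith
  -- `φ(n) = m` at a solution `n ≥ T₁`
  have hval : ∀ n : ℕ, T₁ ≤ (n : ℝ) → ∀ m : ℕ, (g.eval (n : ℤ)).natAbs = m ^ k →
      polyRootFun G (k : ℝ)⁻¹ n = m := by
    intro n hn m hm
    have hpos : 0 < G.eval (n : ℝ) := (hDD n hn).1
    have hGn : G.eval (n : ℝ) = ((g.eval (n : ℤ) : ℤ) : ℝ) := by rw [hG, eval_natCast_map_intCast]
    have hgpos : 0 < g.eval (n : ℤ) := by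
      have h := hpos
      rw [hGn] at h
      exact_mod_cast h
    have hgm : g.eval (n : ℤ) = (m : ℤ) ^ k := by
      rw [← Int.natAbs_of_nonneg hgpos.le, hm]
      push_cast
      ring
    unfold polyRootFun
    rw [hGn, hgm]
    push_cast
    exact Real.pow_rpow_inv_natCast (Nat.cast_nonneg m) hk.ne'
  obtain ⟨m₀, hm₀⟩ := hm₀
  obtain ⟨m₁, hm₁⟩ := hm₁
  obtain ⟨m₂, hm₂⟩ := hm₂
  have hT₀ : T₁ ≤ (n₀ : ℝ) := hy.trans hyn
  have h₀₁R : (n₀ : ℝ) < n₁ := by exact_mod_cast h₀₁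
  have h₁₂R : (n₁ : ℝ) < n₂ := by exact_mod_cast h₁₂
  have hφ₀ := hval n₀ hT₀ m₀ hm₀
  have hφ₁ := hval n₁ (hT₀.trans h₀₁R.le) m₁ hm₁
  have hφ₂ := hval n₂ ((hT₀.trans h₀₁R.le).trans h₁₂R.le) m₂ hm₂
  -- the slope increase is positive and at most `M n₀^{e} (n₂ - n₀) ≤ M y^{e} (n₂ - n₀)`
  obtain ⟨hlt, hle⟩ := polyRootFun_slope_sub_slope_mem G hT₁ hDD he hT₀ h₀₁R h₁₂R
  rw [hφ₀, hφ₁, hφ₂] at hlt hle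
  rw [hdeg] at hle
  have hn₀0 : 0 < (n₀ : ℝ) := by linarith
  have hpow : (n₀ : ℝ) ^ ((g.natDegree : ℝ) / k - 2) ≤ y ^ ((g.natDegree : ℝ) / k - 2) :=
    Real.rpow_le_rpow_of_nonpos hy0 hyn (by rw [← hdeg]; exact he)
  have hle' : ((m₂ : ℤ) - (m₁ : ℤ) : ℝ) / ((n₂ : ℝ) - n₁) - ((m₁ : ℤ) - (m₀ : ℤ) : ℝ) / ((n₁ : ℝ) - n₀)
      ≤ M * y ^ ((g.natDegree : ℝ) / k - 2) * ((n₂ : ℝ) - n₀) := by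
    push_cast
    refine hle.trans ?_
    have hgap : 0 ≤ (n₂ : ℝ) - n₀ := by linarith
    exact mul_le_mul_of_nonneg_right (mul_le_mul_of_nonneg_left hpow hM.le) hgap
  have hlt' : ((m₁ : ℤ) - (m₀ : ℤ) : ℝ) / ((n₁ : ℝ) - n₀) < ((m₂ : ℤ) - (m₁ : ℤ) : ℝ) / ((n₂ : ℝ) - n₁) := by
    push_cast
    linarith
  have h4 := four_le_mul_cube_of_slopes (m₀ : ℤ) m₁ m₂ h₀₁ h₁₂ (c := M * y ^ ((g.natDegree : ℝ) / k - 2))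
    (by push_cast at hlt' ⊢; exact hlt') (by push_cast at hle' ⊢; exact hle')
  exact h4

/-- From `4 ≤ c Δ³` (`c > 0`, `Δ ≥ 0`): `(4/c)^{1/3} ≤ Δ`. -/
theorem rpow_third_le_of_four_le {c Δ : ℝ} (hc : 0 < c) (hΔ : 0 ≤ Δ) (h : 4 ≤ c * Δ ^ 3) :
    (4 / c) ^ ((3 : ℕ) : ℝ)⁻¹ ≤ Δ := by
  have h1 : 4 / c ≤ Δ ^ 3 := by rw [div_le_iff₀ hc]; linarith
  calc (4 / c) ^ ((3 : ℕ) : ℝ)⁻¹ ≤ (Δ ^ 3) ^ ((3 : ℕ) : ℝ)⁻¹ :=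
        Real.rpow_le_rpow (by positivity) h1 (by positivity)
    _ = Δ := Real.pow_rpow_inv_natCast hΔ (by norm_num)

open scoped Classical in
/-- **The `n ≤ x` at which `|g(n)|` is a `k`-th power, `deg g/2 < k < deg g`, are `o(x / log x)`** (`g ∈ ℤ[X]`
with positive leading coefficient; no irreducibility needed). -/
theorem eventually_card_midPowValues_mul_log_le {g : ℤ[X]} {k : ℕ} (hkd : k < g.natDegree)
    (hdk : g.natDegree < 2 * k) (hlc : 0 < g.leadingCoeff) {δ : ℝ} (hδ : 0 < δ) :
    ∀ᶠ x : ℕ in atTop,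
      (#((Icc 1 x).filter fun n : ℕ => ∃ m : ℕ, (g.eval (n : ℤ)).natAbs = m ^ k) : ℝ)
        * Real.log x ≤ δ * x := by
  have hk : 0 < k := by omega
  have hk0 : (0 : ℝ) < k := by exact_mod_cast hk
  set d := g.natDegree with hd
  -- the exponent `e = d/k - 2 < 0` and the saving `η = -e/6 > 0`
  set e : ℝ := (d : ℝ) / k - 2 with he
  have he0 : e < 0 := by
    rw [he, sub_neg, div_lt_iff₀ hk0]
    exact_mod_cast hdk
  set η : ℝ := -e / 6 with hη
  have hη0 : 0 < η := by rw [hη]; linarith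
  obtain ⟨T₁, M, hT₁, hM, hsp⟩ := exists_three_spacing_powValues hk hkd hdk hlc
  -- `log x ≤ c x^r` eventually (`r, c > 0`)
  have hlogr : ∀ {r c : ℝ}, 0 < r → 0 < c → ∀ᶠ x : ℕ in atTop, Real.log x ≤ c * (x : ℝ) ^ r := by
    intro r c hr hc
    have h := ((isLittleO_log_rpow_atTop hr).comp_tendsto tendsto_natCast_atTop_atTop).def hc
    filter_upwards [h] with x hx
    simp only [Function.comp_apply, Real.norm_eq_abs] at hx
    rw [abs_of_nonneg (Real.rpow_nonneg (Nat.cast_nonneg x) r)] at hx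
    exact (le_abs_self _).trans hx
  have hlog1 : ∀ {c : ℝ}, 0 < c → ∀ᶠ x : ℕ in atTop, Real.log x ≤ c * (x : ℝ) := by
    intro c hc
    filter_upwards [hlogr one_pos hc] with x hx
    rwa [Real.rpow_one] at hx
  -- the constant `K = (M/4)^{1/3}` of the main term `2 K x^{1-η}`
  set K : ℝ := (M / 4) ^ ((3 : ℕ) : ℝ)⁻¹ with hK
  have hK0 : 0 < K := by rw [hK]; exact Real.rpow_pos_of_pos (by positivity) _
  set n₁ : ℕ := ⌈T₁⌉₊ with hn₁
  have E1 := hlogr (show (0 : ℝ) < 1 / 2 by norm_num) (show 0 < δ / 4 by positivity)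
  have E2 := hlog1 (show 0 < δ / 4 / (n₁ + 3) by positivity)
  have E3 := hlogr hη0 (show 0 < δ / 4 / (2 * K) by positivity)
  filter_upwards [E1, E2, E3, eventually_ge_atTop (max n₁ 3)] with x hx1 hx2 hx3 hx
  have hxn₁ : n₁ ≤ x := (le_max_left _ _).trans hx
  have hx3' : 3 ≤ x := (le_max_right _ _).trans hx
  have hxpos : (0 : ℝ) < x := by exact_mod_cast (show 0 < x by omega)
  have hlog : 0 ≤ Real.log x := Real.log_nonneg (by exact_mod_cast (show 1 ≤ x by omega))
  -- the threshold `N₀ = max n₁ (⌊√x⌋ + 1)`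
  set N₀ : ℕ := max n₁ (⌊Real.sqrt x⌋₊ + 1) with hN₀
  have hN₀n₁ : n₁ ≤ N₀ := le_max_left _ _
  have hT₁N₀ : T₁ ≤ (N₀ : ℝ) := (Nat.le_ceil T₁).trans (by exact_mod_cast hN₀n₁)
  have hsqrt_le : Real.sqrt x ≤ N₀ := by
    have h1 : Real.sqrt x < (⌊Real.sqrt x⌋₊ : ℝ) + 1 := Nat.lt_floor_add_one _
    have h2 : ((⌊Real.sqrt x⌋₊ + 1 : ℕ) : ℝ) ≤ N₀ := by exact_mod_cast le_max_right _ _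
    push_cast at h2
    linarith
  have hN₀le : (N₀ : ℝ) ≤ n₁ + Real.sqrt x + 1 := by
    have h1 : N₀ ≤ n₁ + (⌊Real.sqrt x⌋₊ + 1) := max_le (Nat.le_add_right _ _) (Nat.le_add_left _ _)
    have h2 : (N₀ : ℝ) ≤ n₁ + (⌊Real.sqrt x⌋₊ + 1) := by exact_mod_cast h1
    have h3 : (⌊Real.sqrt x⌋₊ : ℝ) ≤ Real.sqrt x := Nat.floor_le (Real.sqrt_nonneg _)
    linarith
  have hN₀x : N₀ ≤ x := by
    refine max_le hxn₁ ?_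
    have hx3r : (3 : ℝ) ≤ x := by exact_mod_cast hx3'
    have hs : Real.sqrt x + 1 ≤ x := by
      have hs1 : Real.sqrt x ≤ (x : ℝ) / 2 + 1 / 2 := by
        rw [Real.sqrt_le_left (by positivity)]
        nlinarith
      nlinarith [Real.sq_sqrt hxpos.le, Real.sqrt_nonneg (x : ℝ)]
    have h1 : ((⌊Real.sqrt x⌋₊ + 1 : ℕ) : ℝ) ≤ x := by
      push_cast
      linarith [Nat.floor_le (Real.sqrt_nonneg (x : ℝ))]
    exact_mod_cast h1
  have hN₀pos : (0 : ℝ) < N₀ := by linarith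
  -- the spacing `L = (4/(M N₀^e))^{1/3}` on `[N₀, x]`
  set c : ℝ := M * (N₀ : ℝ) ^ e with hc
  have hc0 : 0 < c := by rw [hc]; exact mul_pos hM (Real.rpow_pos_of_pos hN₀pos e)
  set L : ℝ := (4 / c) ^ ((3 : ℕ) : ℝ)⁻¹ with hL
  have hL0 : 0 < L := by rw [hL]; exact Real.rpow_pos_of_pos (by positivity) _
  set T := (Icc N₀ x).filter (fun n : ℕ => ∃ m : ℕ, (g.eval (n : ℤ)).natAbs = m ^ k) with hT
  have hTsub : T ⊆ Icc N₀ x := filter_subset _ _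
  have hsep : ∀ a ∈ T, ∀ b ∈ T, ∀ b' ∈ T, a < b → b < b' → L ≤ (b' : ℝ) - a := by
    intro a ha b hb b' hb' hab hbb'
    obtain ⟨haI, hma⟩ := mem_filter.mp ha
    obtain ⟨-, hmb⟩ := mem_filter.mp hb
    obtain ⟨-, hmb'⟩ := mem_filter.mp hb'
    have hN₀a : (N₀ : ℝ) ≤ a := by exact_mod_cast (mem_Icc.mp haI).1
    have h4 := hsp N₀ hT₁N₀ a b b' hN₀a hab hbb' hma hmb hmb'
    rw [← hd, ← he, ← hc] at h4
    exact rpow_third_le_of_four_le hc0 (by linarith [show (a : ℝ) < b' by exact_mod_cast hab.trans hbb'])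
      h4
  have hcardT := card_le_of_three_spacing hTsub hN₀x hL0 hsep
  -- `1/L ≤ K x^{-η}`: from `N₀ ≥ √x` and `e < 0`
  have hinvL : 1 / L ≤ K * (x : ℝ) ^ (e / 6) := by
    have hsx : 0 < Real.sqrt x := Real.sqrt_pos.mpr hxpos
    have h1 : (N₀ : ℝ) ^ e ≤ (Real.sqrt x) ^ e := Real.rpow_le_rpow_of_nonpos hsx hsqrt_le he0.le
    have h2 : (Real.sqrt x) ^ e = (x : ℝ) ^ (e / 2) := by
      rw [Real.sqrt_eq_rpow, ← Real.rpow_mul hxpos.le]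
      congr 1
      ring
    have hcle : c ≤ M * (x : ℝ) ^ (e / 2) := by
      rw [hc, ← h2]
      exact mul_le_mul_of_nonneg_left h1 hM.le
    -- `1/L = (c/4)^{1/3}`
    have hinv : 1 / L = (c / 4) ^ ((3 : ℕ) : ℝ)⁻¹ := by
      rw [hL, one_div, ← Real.inv_rpow (by positivity), inv_div]
    rw [hinv, hK]
    calc (c / 4) ^ ((3 : ℕ) : ℝ)⁻¹ ≤ (M * (x : ℝ) ^ (e / 2) / 4) ^ ((3 : ℕ) : ℝ)⁻¹ :=
          Real.rpow_le_rpow (by positivity) (by gcongr) (by positivity)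
      _ = (M / 4 * (x : ℝ) ^ (e / 2)) ^ ((3 : ℕ) : ℝ)⁻¹ := by ring_nf
      _ = (M / 4) ^ ((3 : ℕ) : ℝ)⁻¹ * ((x : ℝ) ^ (e / 2)) ^ ((3 : ℕ) : ℝ)⁻¹ :=
          Real.mul_rpow (by positivity) (by positivity)
      _ = (M / 4) ^ ((3 : ℕ) : ℝ)⁻¹ * (x : ℝ) ^ (e / 6) := by
          rw [← Real.rpow_mul hxpos.le]
          congr 2
          push_cast
          ring
  -- the main term: `(x - N₀)/L · log x ≤ K x^{1 + e/6} log x ≤ δ/8 … `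
  have hmain : ((x : ℝ) - N₀) / L * Real.log x ≤ K * (x : ℝ) ^ (e / 6) * x * Real.log x := by
    have h1 : ((x : ℝ) - N₀) / L ≤ (x : ℝ) * (1 / L) := by
      rw [mul_one_div]
      exact div_le_div_of_nonneg_right (by linarith) hL0.le
    have h2 : (x : ℝ) * (1 / L) ≤ x * (K * (x : ℝ) ^ (e / 6)) := mul_le_mul_of_nonneg_left hinvL hxpos.le
    nlinarith [h1.trans h2, hlog]
  have hxe : (x : ℝ) ^ (e / 6) * (x : ℝ) ^ η = 1 := by
    rw [← Real.rpow_add hxpos, hη, show e / 6 + -e / 6 = 0 by ring, Real.rpow_zero]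
  -- assemble: `#S ≤ (N₀ - 1) + #T ≤ N₀ + 2((x - N₀)/L + 1)`
  have hsplit : (#((Icc 1 x).filter fun n : ℕ => ∃ m : ℕ, (g.eval (n : ℤ)).natAbs = m ^ k) : ℝ)
      ≤ N₀ + #T := by
    have hsub : (Icc 1 x).filter (fun n : ℕ => ∃ m : ℕ, (g.eval (n : ℤ)).natAbs = m ^ k)
        ⊆ range N₀ ∪ T := by
      intro n hn
      obtain ⟨hnI, hmn⟩ := mem_filter.mp hn
      rw [mem_union]
      by_cases hnN : n < N₀
      · exact Or.inl (mem_range.mpr hnN)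
      · exact Or.inr (mem_filter.mpr ⟨mem_Icc.mpr ⟨not_lt.mp hnN, (mem_Icc.mp hnI).2⟩, hmn⟩)
    have h := (card_le_card hsub).trans (card_union_le _ _)
    rw [card_range] at h
    exact_mod_cast h
  have hKne : K ≠ 0 := hK0.ne'
  have hA : ((n₁ : ℝ) + 3) * Real.log x ≤ δ / 4 * x := by
    calc ((n₁ : ℝ) + 3) * Real.log x ≤ ((n₁ : ℝ) + 3) * (δ / 4 / (n₁ + 3) * x) :=
          mul_le_mul_of_nonneg_left hx2 (by positivity)
      _ = δ / 4 * x := by field_simp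
  have hB : Real.sqrt x * Real.log x ≤ δ / 4 * x := by
    rw [Real.sqrt_eq_rpow]
    calc (x : ℝ) ^ (1 / 2 : ℝ) * Real.log x ≤ (x : ℝ) ^ (1 / 2 : ℝ) * (δ / 4 * (x : ℝ) ^ (1 / 2 : ℝ)) :=
          mul_le_mul_of_nonneg_left hx1 (by positivity)
      _ = δ / 4 * ((x : ℝ) ^ (1 / 2 : ℝ) * (x : ℝ) ^ (1 / 2 : ℝ)) := by ring
      _ = δ / 4 * x := by
          rw [← Real.rpow_add hxpos, show (1 / 2 : ℝ) + 1 / 2 = 1 by norm_num, Real.rpow_one]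
  have hC : ((x : ℝ) - N₀) / L * Real.log x ≤ δ / 8 * x := by
    calc ((x : ℝ) - N₀) / L * Real.log x ≤ K * (x : ℝ) ^ (e / 6) * x * Real.log x := hmain
      _ ≤ K * (x : ℝ) ^ (e / 6) * x * (δ / 4 / (2 * K) * (x : ℝ) ^ η) :=
          mul_le_mul_of_nonneg_left hx3 (by positivity)
      _ = δ / 8 * x * ((x : ℝ) ^ (e / 6) * (x : ℝ) ^ η) := by
          field_simp
          ring
      _ = δ / 8 * x := by rw [hxe, mul_one]
  calc (#((Icc 1 x).filter fun n : ℕ => ∃ m : ℕ, (g.eval (n : ℤ)).natAbs = m ^ k) : ℝ) * Real.log x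
      ≤ ((N₀ : ℝ) + #T) * Real.log x := mul_le_mul_of_nonneg_right hsplit hlog
    _ ≤ ((n₁ + Real.sqrt x + 1) + 2 * (((x : ℝ) - N₀) / L + 1)) * Real.log x := by gcongr
    _ = ((n₁ : ℝ) + 3) * Real.log x + Real.sqrt x * Real.log x
          + 2 * (((x : ℝ) - N₀) / L * Real.log x) := by ring
    _ ≤ δ / 4 * x + δ / 4 * x + 2 * (δ / 8 * x) := by gcongr
    _ ≤ δ * x := by nlinarith

end Summit.Parity.BatemanHorn.Theorems
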